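import Summits.BirchSwinnertonDyer.Rank1Residual.GaloisImage.KolyvaginLevelCounting
import HarnessLib

/-!
# Kolyvagin systems of core rank zero vanish: `χ(𝓕) = 0 ⟹ KS₁(T̄, 𝓕, 𝒫) = 0` at the residual
# level `m = 1` (Rubin, PCMI Thm. 2.7.6 = Mazur–Rubin Thm. 4.2.2, the case `R = 𝔽_p`)
# (cell `b2b-bsdres`, team n1011, ROUTE-1 item R1-16, file 3 (main theorem) — lead ruling PLAN.md
# R5-29 (q); seat p11; skeleton `cells/n1011/skel/T-R1-16.md`; files 1–2: `KolyvaginLevelStructures`,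
# `KolyvaginLevelCounting`; file 4 (E[p]-reading): `KolyvaginSystemsCoreRankZeroTorsion`)

HONEST FRAMING (verbatim for the cell): research route; prove what is provable now; shrink each hard
class to its core with data; no claim beyond stated classes; nothing booked; no mark / label moved.
This file is a TOOL theorem about Kolyvagin systems of a finite Galois module — not a class
theorem.  Theorems only: no definition, no named fact, no conjecture node; the one input from the
literature that the tree cannot prove (the Chebotarev prime choice) is an explicit HYPOTHESIS.

## Statement (main theorem `kolyvaginSystems_eq_bot_of_hasCoreRank_zero`)

Let `K` be a number field, `p` a prime, `M` (`= T̄`) a finite discrete `Γ_K`-module killed by `p`,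
`inv` a family of local invariant maps with the Poitou–Tate properties `IsPerfect`,
`SumLocalTermEqZero`, `SelmerComplement` (the tree's fact `poitouTate_selmerStructure_duality K`
provides one), `𝓕` a Selmer structure unramified outside a finite `S ⊇ {v ∣ ∞} ∪ {v ∣ p} ∪ Ram(M)`
whose Selmer group `H¹_𝓕(K, M)` and dual Selmer group `H¹_{𝓕^*}(K, M^D)` are finite, and `D` a
Kolyvagin datum (`Literature/…/GaloisCohomology/KolyvaginSystems.lean`: the primes `𝒫`, the
transverse conditions `H¹_tr`, the finite–singular comparison maps `φ^{fs}`) with `𝒫 ∩ S = ∅`,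
admissible comparison maps (`φ^{fs}_𝔮 : H¹_ur ⥲ H¹_{/ur}`), and at every `𝔮 ∈ 𝒫` the local shape
of Rubin, PCMI Prop. 1.9.5 (1) / Ex. 1.9.7 (= Mazur–Rubin Lemma 1.2.3):
`#H¹_ur(K_𝔮, M) = #H¹_tr(K_𝔮, M) = p` and `H¹(K_𝔮, M) = H¹_ur + H¹_tr`.  Assume the PRIME CHOICE
(hypothesis `hprime`; Rubin Prop. 2.7.1 = Mazur–Rubin Prop. 3.6.1, whose proof is the Chebotarev
density theorem; at `p = 3`: Sakamoto, JTNB 36 (2024) Cor. 5.5, p. 929): for a level `d`, a non-zero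
`c ∈ H¹_{𝓕(d)}(K, M)` and a non-zero `c' ∈ H¹_{𝓕(d)^*}(K, M^D)` there is `𝔮 ∈ 𝒫 ∖ d` with
`loc_𝔮 c ≠ 0 ≠ loc_𝔮 c'`.  THEN: **if `χ(𝓕) = 0` (`LocalInvariants.HasCoreRank inv 𝓕 p 0`, i.e.
`#H¹_𝓕(K, M) = #H¹_{𝓕^*}(K, M^D)`), the group `KS₁(M, 𝓕, 𝒫)` of Kolyvagin systems is zero.**

This is Rubin, *Euler systems and Kolyvagin systems* (PCMI 18, 2011), Thm. 2.7.6 "If `χ(A) = 0`,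
then `KS(A) = 0`" in the case `m = 1` (`R = 𝔽_p`, `A = Ā`), which is Mazur–Rubin, *Kolyvagin
systems* (Mem. AMS 799, 2004), Thm. 4.2.2 for `k = 1`; at the residual level the hypotheses (H.5)
and the `𝔪`-adic induction of Mazur–Rubin §4.3 do not arise ("the condition on `𝓕` is vacuous if
`m = 1`", Rubin Rem. 2.4.1).  The big-image hypotheses (H.1)–(H.4) of print enter ONLY through the
prime choice, which is why they are replaced here by the single binder `hprime`.

## Proof (Rubin, Lecture 2, pp. 17–24) and the decls of this file

Files 1–2 (`KolyvaginLevelStructures`, `KolyvaginLevelCounting`) supply: the unfolding of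
`𝓕(d)`, `𝓕(d𝔮)`, `𝓕_𝔮(d)`, `𝓕^𝔮(d)` and their finiteness; pair counting at one place
(`card_selmerGroup_pair_one_place`, from T-a3-F1 CR1 `card_selmerGroup_pair`); the constancy of the
core rank along levels (`card_selmerGroup_atLevel_mul`, Rubin Ex. 2.1.4); and the dual-side step
`#H¹_{𝓕(d𝔮)^*} < #H¹_{𝓕(d)^*}` (`card_dualSelmerGroup_atLevel_insert_lt`, Cor. 2.6.2 (4)).  Here:
* §8 `apply_insert_ne_zero_of_localization_ne_zero` (proof of Cor. 2.7.2: `loc_𝔮 κ_d ≠ 0 ⟹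
  loc_𝔮 κ_{d𝔮} ≠ 0`, by the finite–singular relation and admissibility) and the MAIN theorem
  (Thm. 2.7.6: strong induction on `#H¹_{𝓕(d)^*}`; at `λ^*(d) = 0`, `χ = 0` gives `H¹_{𝓕(d)} = 0`,
  Ex. 2.5.4 (4); otherwise `hprime` moves to `d𝔮` with `κ_{d𝔮} ≠ 0` and a smaller dual Selmer group);
* §9 corollaries: element form `apply_eq_zero_of_isKolyvaginSystem`; the prime choice in the printed
  "infinitely many primes" shape over all non-zero global classes (`…_of_infinite`, Rubin
  Prop. 2.7.1); and in SAKAMOTO's shape (`…_of_selfDual`): three non-zero classes of `H¹(K, T̄)`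
  only (Sakamoto, JTNB 36 (2024) Cor. 5.5, `p = 3`), the dual class transported by an equivariant
  `θ' : T̄^∨(1) → T̄` injective on `H¹` (naturality `localization_map_one_eq`);
* the reading for `T̄ = E[p]` (`θ'` = the inverse Weil transport of `X11b/WeilTransport.lean`) is the
  sibling file `KolyvaginSystemsCoreRankZeroTorsion.lean`.

## Hypothesis ledger (every binder is used; none is a minted fact)

`hperf/hsum/hcompl` (Poitou–Tate family: cited fact, consumer's `obtain`); `hM` (`p·M = 0`);
`hS`, `h𝓕` (Howard Def. 2.1.10); `hfin`, `hfind` (finite Selmer groups — necessary for a counting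
statement); `hχ` (THE hypothesis); `hPS` (`𝒫 ∩ S(𝓕) = ∅`, Rubin Def. 2.1.3); `hadm` (Rubin
Ex. 1.9.7; only injectivity of `φ^{fs}_𝔮` on `H¹_ur` is used); `hU`, `hT`, `hUT` (the local shape at
Kolyvagin primes, Rubin Prop. 1.9.5 (1) / Ex. 1.9.7 — NOT in the tree, "properties of the prime set
carried by the consumer" per `FiniteSingularComparison.lean`; the intersection `H¹_ur ∩ H¹_tr = 0`
and `#H¹(K_𝔮, M) = p²` are not needed); `hprime` / `hC55` (the prime choice — typer backlog
TB-S24C55 (ex TB-S22C55) of the cell types Sakamoto's Cor. 5.5 itself; Chebotarev is not in the tree).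

## References

* [Rubin2011] K. Rubin, *Euler systems and Kolyvagin systems*, IAS/Park City Math. Ser. 18 (2011),
  Lecture 1: Prop. 1.9.5, Ex. 1.9.7, Thm. 1.10.2; Lecture 2: Def. 2.1.1, Def. 2.1.3, Ex. 2.1.4,
  Def. 2.2.1, Thm. 2.5.2, Def. 2.5.3, Ex. 2.5.4, Prop. 2.6.1, Cor. 2.6.2, Prop. 2.7.1, Cor. 2.7.2,
  Cor. 2.7.3, Thm. 2.7.6 (pp. 14–24) — read (held, doi:10.1090/pcms/018/14).
* [Sakamoto2024] R. Sakamoto, *The theory of Kolyvagin systems for `p = 3`*, J. Théor. Nombres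
  Bordeaux 36 (2024) 919–946: §§2–4 (the vocabulary of `KolyvaginSystems.lean`); §5 "Application of
  the Chebotarev density theorem", Lemma 5.2 (p. 928), Rem. 5.3, Cor. 5.5 (pp. 929–930) — the
  `p = 3` prime choice over a general number field `K` with the `τ`-class primes
  (`frobeniusClassPrimes`); read by the cell's literature seat (LIT-INPUTS-P3 §26; the arXiv
  precursor arXiv:2106.03370v2 §5 states it over `ℚ` and is not in the published Doc. Math. text).
* B. Mazur, K. Rubin, *Kolyvagin systems*, Mem. AMS 799 (2004), Prop. 3.6.1, Thm. 4.2.2 — cited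
  through [Rubin2011] (not held, acq-02261; not needed at `m = 1`).
-/
noncomputable section

open scoped Classical NumberField ContRepresentation
open Function NumberField IsDedekindDomain
open Literature.NumberTheory.GaloisRepresentations Literature.NumberTheory.GaloisRepresentations.DiscreteGaloisModule
  Literature.NumberTheory.GaloisCohomology

universe u

namespace Summit.BirchSwinnertonDyer.Rank1Residual.GaloisImage.CoreRankZero

variable {K : Type u} [Field K] [NumberField K] {n : ℕ}
variable {M : Type u} [AddCommGroup M] [TopologicalSpace M] [DiscreteTopology M] [Finite M]
variable {ρ : DiscreteGaloisModule K M}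

/-! ## §8. Kolyvagin systems: one step up the Selmer graph, and the vanishing theorem -/

omit [Finite M] in
/-- **`loc_𝔮 κ_d ≠ 0 ⟹ κ_{d𝔮} ≠ 0`** for a Kolyvagin system with admissible comparison maps
(`φ^{fs}_𝔮` injective on `H¹_ur`): the finite–singular relation `v_𝔮(κ_{d𝔮}) = φ^{fs}_𝔮(loc_𝔮 κ_d)`
(Rubin, proof of Cor. 2.7.2: "`Res_ℓ(κ_n) ≠ 0`, so `Res_ℓ(κ_{nℓ}) ≠ 0` (by definition of a Kolyvagin
system), so `κ_{nℓ} ≠ 0`"). [cite: Rubin2011, Cor. 2.7.2, proof (p. 24)] -/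
theorem apply_insert_ne_zero_of_localization_ne_zero {S : Finset (Place K)} {𝓕 : SelmerStructure ρ}
    (h𝓕 : 𝓕.IsUnramifiedOutside S) {D : KolyvaginDatum ρ}
    (hPS : ∀ q ∈ D.primes, (Sum.inr q : Place K) ∉ S) (hadm : D.IsAdmissible)
    {κ : Finset (HeightOneSpectrum (𝓞 K)) → galoisCohomology ρ 1} (hκ : D.IsKolyvaginSystem 𝓕 κ)
    {d : Finset (HeightOneSpectrum (𝓞 K))} (hd : D.IsLevel d) {q : HeightOneSpectrum (𝓞 K)}
    (hq : q ∈ D.primes) (hqd : q ∉ d)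
    (hxq : galoisCohomology.localization ρ (Sum.inr q) 1 (κ d) ≠ 0) :
    galoisCohomology.localization ρ (Sum.inr q) 1 (κ (insert q d)) ≠ 0 := by
  intro h0
  -- `loc_𝔮 κ_d` is an unramified class (`𝓕(d)_𝔮 = 𝓕_𝔮 = H¹_ur`, `𝔮 ∉ S ∪ d`)
  have hmem : galoisCohomology.localization ρ (Sum.inr q) 1 (κ d) ∈
      unramifiedSubgroup (GaloisRep.toLocal q ρ) 1 := by
    have h := (SelmerStructure.mem_selmerGroup_iff _ _).mp (hκ.mem_selmerGroup d hd) (Sum.inr q)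
    rwa [Level.atLevel_inr_of_not_mem D 𝓕 hqd, h𝓕.2 q (hPS q hq)] at h
  -- the finite–singular relation: `v_𝔮(κ_{d𝔮}) = φ^{fs}_𝔮(loc_𝔮 κ_d)`, and the left side vanishes
  have hrel := hκ.fs_rel d hd q hq hqd
  have hL : KolyvaginDatum.singularLocalization ρ q (κ (insert q d)) =
      singularMap (GaloisRep.toLocal q ρ)
        (galoisCohomology.localization ρ (Sum.inr q) 1 (κ (insert q d))) := rfl
  have hR : D.fsLocalization q (κ d) =
      D.fs q (galoisCohomology.localization ρ (Sum.inr q) 1 (κ d)) := rfl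
  -- `h0`, read in `H¹(K_𝔮, M)` presented as `GaloisRep.toLocal q ρ` (definitionally the same group)
  have h0' : @Eq (galoisCohomology (GaloisRep.toLocal q ρ) 1)
      (galoisCohomology.localization ρ (Sum.inr q) 1 (κ (insert q d))) 0 := h0
  rw [hL, hR, h0', map_zero] at hrel
  -- admissibility: `φ^{fs}_𝔮` is injective on `H¹_ur`
  have hinj := (hadm q hq).1
  have hx0 : (⟨_, hmem⟩ : unramifiedSubgroup (GaloisRep.toLocal q ρ) 1) = 0 := by
    apply hinj
    show D.fs q _ = D.fs q _
    simp only [ZeroMemClass.coe_zero, map_zero]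
    exact hrel.symm
  apply hxq
  have hval := congrArg Subtype.val hx0
  rw [ZeroMemClass.coe_zero] at hval
  exact hval

/-- **Rubin, PCMI Thm. 2.7.6 at `m = 1` (Mazur–Rubin Thm. 4.2.2, `χ = 0`): if the core rank of `𝓕`
is zero then every Kolyvagin system for `(T̄, 𝓕, 𝒫)` vanishes.**  Setting: `K` a number field,
`M = T̄` a finite discrete `Γ_K`-module killed by the prime `p`; `inv` a Poitou–Tate family of local
invariant maps (`IsPerfect`, `SumLocalTermEqZero`, `SelmerComplement` — the tree's fact
`poitouTate_selmerStructure_duality` supplies one); `𝓕` a Selmer structure unramified outside the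
finite `S ⊇ {v ∣ ∞} ∪ {v ∣ p} ∪ Ram(M)` with `H¹_𝓕(K, M)` and `H¹_{𝓕^*}(K, M^D)` finite and
**`χ(𝓕) = 0`** (`HasCoreRank inv 𝓕 p 0`: `#H¹_𝓕(K, M) = #H¹_{𝓕^*}(K, M^D)`); `D` a Kolyvagin datum
whose primes `𝒫` lie outside `S` and satisfy, at each `𝔮 ∈ 𝒫`, Rubin's Prop. 1.9.5 (1) / Ex. 1.9.7
(`#H¹_ur(K_𝔮, M) = #H¹_tr(K_𝔮, M) = p`, `H¹ = H¹_ur + H¹_tr`) with admissible comparison maps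
(`φ^{fs}_𝔮 : H¹_ur ⥲ H¹_{/ur}`); and the PRIME-CHOICE input of Rubin Prop. 2.7.1 = Mazur–Rubin
Prop. 3.6.1 (at `p = 3`: Sakamoto, JTNB 36 (2024) Cor. 5.5, with the dual class transported to
`H¹(K, T̄)` by the residual self-duality) as the hypothesis `hprime`: for a level `d`, a non-zero
`c ∈ H¹_{𝓕(d)}(K, M)` and a non-zero `c' ∈ H¹_{𝓕(d)^*}(K, M^D)` there is `𝔮 ∈ 𝒫`, `𝔮 ∉ d`, with
`loc_𝔮 c ≠ 0 ≠ loc_𝔮 c'`.  CONCLUSION: `KS₁(M, 𝓕, 𝒫) = 0`.  Proof (Rubin): if `κ_d ≠ 0` walk to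
`d𝔮` with `κ_{d𝔮} ≠ 0` and `λ^*(d𝔮) = λ^*(d) − 1` (Cor. 2.7.2) until `λ^*(d₀) = 0`, where `χ = 0`
gives `H¹_{𝓕(d₀)} = 0` (Ex. 2.5.4 (4)) — contradiction.
[cite: Rubin2011, Thm. 2.7.6 (p. 24), with Prop. 2.7.1, Cor. 2.7.2–2.7.3, Ex. 2.5.4 (4)] -/
theorem kolyvaginSystems_eq_bot_of_hasCoreRank_zero {p : ℕ} [Fact p.Prime] {inv : LocalInvariants K p}
    (hperf : inv.IsPerfect) (hsum : inv.SumLocalTermEqZero) (hcompl : inv.SelmerComplement)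
    (hM : ∀ m : M, p • m = 0) {S : Finset (Place K)}
    (hS : ∀ v : HeightOneSpectrum (𝓞 K), (Sum.inr v : Place K) ∉ S →
      ((p : ℕ) : 𝓞 K) ∉ v.asIdeal ∧ GaloisRep.IsUnramifiedAt v ρ)
    {𝓕 : SelmerStructure ρ} (h𝓕 : 𝓕.IsUnramifiedOutside S)
    (hfin : Finite 𝓕.selmerGroup) (hfind : Finite (inv.dualSelmerStructure ρ 𝓕).selmerGroup)
    (hχ : LocalInvariants.HasCoreRank inv 𝓕 p 0)
    {D : KolyvaginDatum ρ} (hPS : ∀ q ∈ D.primes, (Sum.inr q : Place K) ∉ S)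
    (hadm : D.IsAdmissible)
    (hU : ∀ q ∈ D.primes, Nat.card (unramifiedSubgroup (GaloisRep.toLocal q ρ) 1) = p)
    (hT : ∀ q ∈ D.primes, Nat.card (D.transverse (Sum.inr q)) = p)
    (hUT : ∀ q ∈ D.primes,
      unramifiedSubgroup (GaloisRep.toLocal q ρ) 1 ⊔ D.transverse (Sum.inr q) = ⊤)
    (hprime : ∀ d, D.IsLevel d → ∀ c ∈ (D.atLevel 𝓕 d).selmerGroup,
      ∀ c' ∈ (inv.dualSelmerStructure ρ (D.atLevel 𝓕 d)).selmerGroup, c ≠ 0 → c' ≠ 0 →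
        ∃ q ∈ D.primes, q ∉ d ∧ galoisCohomology.localization ρ (Sum.inr q) 1 c ≠ 0 ∧
          galoisCohomology.localization (ρ.tateDual p) (Sum.inr q) 1 c' ≠ 0) :
    D.kolyvaginSystems 𝓕 = ⊥ := by
  classical
  rw [eq_bot_iff]
  intro κ hκ
  rw [KolyvaginDatum.mem_kolyvaginSystems_iff] at hκ
  rw [AddSubgroup.mem_bot]
  funext d
  rw [Pi.zero_apply]
  by_cases hd : D.IsLevel d
  swap
  · exact hκ.eq_zero_of_not_isLevel d hd
  -- strong induction on `#H¹_{𝓕(d)^*}(K, M^D)` over all levels `d`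
  suffices h : ∀ (N : ℕ) (d : Finset (HeightOneSpectrum (𝓞 K))), D.IsLevel d →
      Nat.card (inv.dualSelmerStructure ρ (D.atLevel 𝓕 d)).selmerGroup = N → κ d = 0 from
    h _ d hd rfl
  intro N
  induction N using Nat.strong_induction_on with
  | _ N ih =>
    intro d hd hN
    haveI := finite_selmerGroup_atLevel D 𝓕 hfin d
    haveI := finite_dualSelmerGroup_atLevel inv D 𝓕 hfind d
    by_contra hne
    by_cases hbot : (inv.dualSelmerStructure ρ (D.atLevel 𝓕 d)).selmerGroup = ⊥
    · -- `λ^*(d) = 0` and `χ = 0` force `H¹_{𝓕(d)} = 0` (Rubin Ex. 2.5.4 (4))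
      have hmul := card_selmerGroup_atLevel_mul hperf hsum hcompl hM hS h𝓕 hfin hfind hPS
        (fun q hq => by rw [hU q hq, hT q hq]) hd
      rw [LocalInvariants.HasCoreRank, pow_zero, one_mul] at hχ
      rw [hbot, AddSubgroup.card_bot, mul_one, ← hχ] at hmul
      have hF : Nat.card 𝓕.selmerGroup ≠ 0 := Nat.card_pos.ne'
      have h1 : Nat.card (D.atLevel 𝓕 d).selmerGroup = 1 := by
        refine mul_right_cancel₀ hF ?_
        rw [hmul, one_mul]
      have hSel : (D.atLevel 𝓕 d).selmerGroup = ⊥ := AddSubgroup.card_eq_one.1 h1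
      have hmem := hκ.mem_selmerGroup d hd
      rw [hSel, AddSubgroup.mem_bot] at hmem
      exact hne hmem
    · -- walk one step up the Selmer graph (Rubin Cor. 2.7.2) and use the induction hypothesis
      obtain ⟨y, hy, hy0⟩ := (AddSubgroup.bot_or_exists_ne_zero _).resolve_left hbot
      obtain ⟨q, hq, hqd, hcq, hyq⟩ :=
        hprime d hd (κ d) (hκ.mem_selmerGroup d hd) y hy hne hy0
      have hstep := apply_insert_ne_zero_of_localization_ne_zero h𝓕 hPS hadm hκ hd hq hqd hcq
      have hlt := card_dualSelmerGroup_atLevel_insert_lt hperf hsum hcompl hM hS h𝓕 hfin hfind hPS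
        hU hUT d hq hqd (hκ.mem_selmerGroup d hd) hcq hy hyq
      have hzero := ih _ (hN ▸ hlt) (insert q d) (hd.insert hq) rfl
      exact hstep (by rw [hzero, map_zero])

/-! ## §9. Corollaries: element form; the print-shaped prime-choice hypotheses -/

/-- **Element form of the vanishing theorem**: under the hypotheses of
`kolyvaginSystems_eq_bot_of_hasCoreRank_zero`, every Kolyvagin system `κ` for `(T̄, 𝓕, 𝒫)` has
`κ_d = 0` for every `d`. [cite: Rubin2011, Thm. 2.7.6 (p. 24)] -/
theorem apply_eq_zero_of_isKolyvaginSystem {p : ℕ} [Fact p.Prime] {inv : LocalInvariants K p}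
    (hperf : inv.IsPerfect) (hsum : inv.SumLocalTermEqZero) (hcompl : inv.SelmerComplement)
    (hM : ∀ m : M, p • m = 0) {S : Finset (Place K)}
    (hS : ∀ v : HeightOneSpectrum (𝓞 K), (Sum.inr v : Place K) ∉ S →
      ((p : ℕ) : 𝓞 K) ∉ v.asIdeal ∧ GaloisRep.IsUnramifiedAt v ρ)
    {𝓕 : SelmerStructure ρ} (h𝓕 : 𝓕.IsUnramifiedOutside S)
    (hfin : Finite 𝓕.selmerGroup) (hfind : Finite (inv.dualSelmerStructure ρ 𝓕).selmerGroup)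
    (hχ : LocalInvariants.HasCoreRank inv 𝓕 p 0)
    {D : KolyvaginDatum ρ} (hPS : ∀ q ∈ D.primes, (Sum.inr q : Place K) ∉ S)
    (hadm : D.IsAdmissible)
    (hU : ∀ q ∈ D.primes, Nat.card (unramifiedSubgroup (GaloisRep.toLocal q ρ) 1) = p)
    (hT : ∀ q ∈ D.primes, Nat.card (D.transverse (Sum.inr q)) = p)
    (hUT : ∀ q ∈ D.primes,
      unramifiedSubgroup (GaloisRep.toLocal q ρ) 1 ⊔ D.transverse (Sum.inr q) = ⊤)
    (hprime : ∀ d, D.IsLevel d → ∀ c ∈ (D.atLevel 𝓕 d).selmerGroup,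
      ∀ c' ∈ (inv.dualSelmerStructure ρ (D.atLevel 𝓕 d)).selmerGroup, c ≠ 0 → c' ≠ 0 →
        ∃ q ∈ D.primes, q ∉ d ∧ galoisCohomology.localization ρ (Sum.inr q) 1 c ≠ 0 ∧
          galoisCohomology.localization (ρ.tateDual p) (Sum.inr q) 1 c' ≠ 0)
    {κ : Finset (HeightOneSpectrum (𝓞 K)) → galoisCohomology ρ 1} (hκ : D.IsKolyvaginSystem 𝓕 κ)
    (d : Finset (HeightOneSpectrum (𝓞 K))) : κ d = 0 := by
  have h := kolyvaginSystems_eq_bot_of_hasCoreRank_zero hperf hsum hcompl hM hS h𝓕 hfin hfind hχ hPS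
    hadm hU hT hUT hprime
  have hκ' : κ ∈ D.kolyvaginSystems 𝓕 := (KolyvaginDatum.mem_kolyvaginSystems_iff D 𝓕 κ).2 hκ
  rw [h, AddSubgroup.mem_bot] at hκ'
  rw [hκ', Pi.zero_apply]

/-- **The vanishing theorem with the prime-choice hypothesis in the printed "infinitely many primes"
form** (Rubin Prop. 2.7.1: the set `{ℓ ∈ 𝒫 : Res_ℓ(c) ≠ 0 and Res_ℓ(d) ≠ 0}` has positive
density — here: is infinite — for non-zero `c ∈ H¹(K, M)`, `d ∈ H¹(K, M^D)`); a prime outside the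
finite level `d` is then always available. [cite: Rubin2011, Prop. 2.7.1 and Thm. 2.7.6 (pp. 23–24)] -/
theorem kolyvaginSystems_eq_bot_of_hasCoreRank_zero_of_infinite {p : ℕ} [Fact p.Prime]
    {inv : LocalInvariants K p}
    (hperf : inv.IsPerfect) (hsum : inv.SumLocalTermEqZero) (hcompl : inv.SelmerComplement)
    (hM : ∀ m : M, p • m = 0) {S : Finset (Place K)}
    (hS : ∀ v : HeightOneSpectrum (𝓞 K), (Sum.inr v : Place K) ∉ S →
      ((p : ℕ) : 𝓞 K) ∉ v.asIdeal ∧ GaloisRep.IsUnramifiedAt v ρ)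
    {𝓕 : SelmerStructure ρ} (h𝓕 : 𝓕.IsUnramifiedOutside S)
    (hfin : Finite 𝓕.selmerGroup) (hfind : Finite (inv.dualSelmerStructure ρ 𝓕).selmerGroup)
    (hχ : LocalInvariants.HasCoreRank inv 𝓕 p 0)
    {D : KolyvaginDatum ρ} (hPS : ∀ q ∈ D.primes, (Sum.inr q : Place K) ∉ S)
    (hadm : D.IsAdmissible)
    (hU : ∀ q ∈ D.primes, Nat.card (unramifiedSubgroup (GaloisRep.toLocal q ρ) 1) = p)
    (hT : ∀ q ∈ D.primes, Nat.card (D.transverse (Sum.inr q)) = p)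
    (hUT : ∀ q ∈ D.primes,
      unramifiedSubgroup (GaloisRep.toLocal q ρ) 1 ⊔ D.transverse (Sum.inr q) = ⊤)
    (hprime : ∀ c : galoisCohomology ρ 1, c ≠ 0 → ∀ c' : galoisCohomology (ρ.tateDual p) 1, c' ≠ 0 →
      {q ∈ D.primes | galoisCohomology.localization ρ (Sum.inr q) 1 c ≠ 0 ∧
        galoisCohomology.localization (ρ.tateDual p) (Sum.inr q) 1 c' ≠ 0}.Infinite) :
    D.kolyvaginSystems 𝓕 = ⊥ := by
  refine kolyvaginSystems_eq_bot_of_hasCoreRank_zero hperf hsum hcompl hM hS h𝓕 hfin hfind hχ hPS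
    hadm hU hT hUT fun d _ c _ c' _ hc hc' => ?_
  obtain ⟨q, ⟨hq, hcq, hc'q⟩, hqd⟩ := (hprime c hc c' hc').exists_notMem_finset d
  exact ⟨q, hq, hqd, hcq, hc'q⟩

omit [Finite M] in
/-- Naturality of localisation in degree one: `loc_v (H¹(f) c) = H¹(f|_{Γ_{K_v}}) (loc_v c)`
(the tree's `galoisCohomology.res_map_one` at `K_v`). [folklore] -/
theorem localization_map_one_eq {N : Type u} [AddCommGroup N] [TopologicalSpace N]
    [DiscreteTopology N] {ρ' : DiscreteGaloisModule K N}
    (f : ρ'.toContRepresentation →ⁱL ρ.toContRepresentation) (v : Place K)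
    (c : galoisCohomology ρ' 1) :
    galoisCohomology.localization ρ v 1 (galoisCohomology.map f 1 c) =
      galoisCohomology.map (f.restrictField (Place.Completion v)) 1
        (galoisCohomology.localization ρ' v 1 c) :=
  galoisCohomology.res_map_one (Place.Completion v) f c

/-- **The vanishing theorem with the prime-choice hypothesis in Sakamoto's form (residual
self-duality).**  If an equivariant map `θ' : T̄^∨(1) → T̄` (the inverse of the (H.SD) self-duality
`T̄ ≅ T̄^∨(1)`; for `T̄ = E[p]` the inverse Weil transport) is injective on `H¹(K, ·)`, then the
prime-choice input may be given for classes of `H¹(K, T̄)` only, in the shape of Sakamoto, JTNB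
36 (2024), Cor. 5.5 (p. 929; `p = 3`, any number field `K`, `𝒫` the `τ`-class primes of §2): "Let
`c₁, c₂, c₃ ∈ H¹(K, T̄)` be non-zero elements. Then there are infinitely many primes `𝔮 ∈ 𝒫`
satisfying `loc_𝔮(c_i) ≠ 0` for any `1 ≤ i ≤ 3`" (proved from Lemma 5.2, p. 928, by the Chebotarev
density theorem), read on the prime set `𝒫` of the datum.  The dual class `c'` is transported to
`H¹(K, T̄)` by `H¹(θ')`, and `loc_𝔮 (H¹(θ') c') ≠ 0 ⟹ loc_𝔮 c' ≠ 0` by naturality.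
[cite: Sakamoto2024, Cor. 5.5 (p. 929) and Lemma 5.2 (p. 928)]
[cite: Rubin2011, Prop. 2.7.1 and Thm. 2.7.6 (pp. 23–24)] -/
theorem kolyvaginSystems_eq_bot_of_hasCoreRank_zero_of_selfDual {p : ℕ} [Fact p.Prime]
    {inv : LocalInvariants K p}
    (hperf : inv.IsPerfect) (hsum : inv.SumLocalTermEqZero) (hcompl : inv.SelmerComplement)
    (hM : ∀ m : M, p • m = 0) {S : Finset (Place K)}
    (hS : ∀ v : HeightOneSpectrum (𝓞 K), (Sum.inr v : Place K) ∉ S →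
      ((p : ℕ) : 𝓞 K) ∉ v.asIdeal ∧ GaloisRep.IsUnramifiedAt v ρ)
    {𝓕 : SelmerStructure ρ} (h𝓕 : 𝓕.IsUnramifiedOutside S)
    (hfin : Finite 𝓕.selmerGroup) (hfind : Finite (inv.dualSelmerStructure ρ 𝓕).selmerGroup)
    (hχ : LocalInvariants.HasCoreRank inv 𝓕 p 0)
    {D : KolyvaginDatum ρ} (hPS : ∀ q ∈ D.primes, (Sum.inr q : Place K) ∉ S)
    (hadm : D.IsAdmissible)
    (hU : ∀ q ∈ D.primes, Nat.card (unramifiedSubgroup (GaloisRep.toLocal q ρ) 1) = p)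
    (hT : ∀ q ∈ D.primes, Nat.card (D.transverse (Sum.inr q)) = p)
    (hUT : ∀ q ∈ D.primes,
      unramifiedSubgroup (GaloisRep.toLocal q ρ) 1 ⊔ D.transverse (Sum.inr q) = ⊤)
    (θ' : (ρ.tateDual p).toContRepresentation →ⁱL ρ.toContRepresentation)
    (hθ' : Injective (galoisCohomology.map θ' 1))
    (hC55 : ∀ c₁ c₂ c₃ : galoisCohomology ρ 1, c₁ ≠ 0 → c₂ ≠ 0 → c₃ ≠ 0 →
      {q ∈ D.primes | galoisCohomology.localization ρ (Sum.inr q) 1 c₁ ≠ 0 ∧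
        galoisCohomology.localization ρ (Sum.inr q) 1 c₂ ≠ 0 ∧
        galoisCohomology.localization ρ (Sum.inr q) 1 c₃ ≠ 0}.Infinite) :
    D.kolyvaginSystems 𝓕 = ⊥ := by
  refine kolyvaginSystems_eq_bot_of_hasCoreRank_zero_of_infinite hperf hsum hcompl hM hS h𝓕 hfin hfind
    hχ hPS hadm hU hT hUT fun c hc c' hc' => ?_
  have hc'' : galoisCohomology.map θ' 1 c' ≠ 0 := fun h => hc' (hθ' (by rw [h, map_zero]))
  refine (hC55 c _ _ hc hc'' hc'').mono fun q hq => ⟨hq.1, hq.2.1, fun h0 => hq.2.2.1 ?_⟩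
  rw [localization_map_one_eq, h0]
  exact map_zero _

end Summit.BirchSwinnertonDyer.Rank1Residual.GaloisImage.CoreRankZero

end
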